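import Mathlib.LinearAlgebra.Matrix.Rank
import HarnessLib

/-!
# Rank lower bounds from triangular row combinations ("row-operation certificates")

Topic `Literature/LinearAlgebra/Matrix`; a trunk-independent tool. To certify `rank A ≥ N` for an
explicit matrix `A` over a field one exhibits row combinations of `A` that are "triangular": rows
`R₁, …, R_N` in the row space of `A` and columns `c₁, …, c_N` with `Rᵢ(cᵢ) ≠ 0` and `Rᵢ(cⱼ) = 0`
whenever `j` comes before `i` in some injective ranking `key : ι → α` into a linear order (no order
on the index type `ι` itself is needed, and `key` may rank lexicographically by several
parameters). Such rows are linearly independent (look at the `key`-first row with a non-zero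
coefficient and its pivot column), so `rank A ≥ rank (P A) = N` for the matrix `P` of
coefficients. Everything here is PROVED:

* `linearIndependent_of_keyTriangular`, `rank_eq_card_of_keyTriangular`,
  `card_le_rank_of_keyTriangular_mul`.

Intended use (first client: the Koszul-flattening ranks of Conner–Gesmundo–Landsberg–Ventura 2022,
Thm. 3.3, `Computability/AlgebraicComplexity/BorderRankCWKoszulRanksProofs.lean`): the entries of
`A` are values at `t = q - 3` of fixed integer polynomials, a certificate `P` over `ℤ[t]` is found
by exact elimination outside Lean, `decide` checks triangularity of `P A` on coefficient lists
(`Algebra/Polynomial/CoeffList.lean`), and the lemmas here transport the check to every `q`.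
-/

namespace Literature.LinearAlgebra.Matrix

open _root_.Matrix

variable {F : Type*} [Field F] {ι κ α : Type*} [Fintype ι] [LinearOrder α]

/-- Rows `M i` with a "pivot column" `c i` each — `M i (c i) ≠ 0` and `M i (c j) = 0` whenever
`key j < key i` for an injective ranking `key` — are linearly independent. [folklore] -/
theorem linearIndependent_of_keyTriangular (M : Matrix ι κ F) (c : ι → κ) (key : ι → α)
    (hkey : Function.Injective key) (h0 : ∀ i, M i (c i) ≠ 0)
    (h1 : ∀ i j, key j < key i → M i (c j) = 0) : LinearIndependent F M.row := by
  classical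
  rw [Fintype.linearIndependent_iff]
  intro g hg
  by_contra hne
  obtain ⟨i₁, hi₁⟩ := not_forall.mp hne
  set s : Finset ι := Finset.univ.filter fun i => g i ≠ 0 with hs
  have hsne : s.Nonempty := ⟨i₁, by simp [hs, hi₁]⟩
  obtain ⟨i₀, hi₀s, hmin⟩ := s.exists_min_image key hsne
  have hgi₀ : g i₀ ≠ 0 := by simpa [hs] using hi₀s
  have hsum := congrFun hg (c i₀)
  simp only [Finset.sum_apply, Pi.smul_apply, smul_eq_mul, Pi.zero_apply] at hsum
  rw [Finset.sum_eq_single i₀] at hsum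
  · exact hgi₀ ((mul_eq_zero.1 hsum).resolve_right (h0 i₀))
  · intro i _ hi
    by_cases hgi : g i = 0
    · rw [hgi, zero_mul]
    · have his : i ∈ s := by simp [hs, hgi]
      have hlt : key i₀ < key i :=
        lt_of_le_of_ne (hmin i his) fun h => hi (hkey h).symm
      rw [Matrix.row_apply, h1 i i₀ hlt, mul_zero]
  · intro h
    exact absurd (Finset.mem_univ i₀) h

variable [Fintype κ]

/-- A key-triangular matrix has rank equal to its number of rows. [folklore] -/
theorem rank_eq_card_of_keyTriangular (M : Matrix ι κ F) (c : ι → κ) (key : ι → α)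
    (hkey : Function.Injective key) (h0 : ∀ i, M i (c i) ≠ 0)
    (h1 : ∀ i j, key j < key i → M i (c j) = 0) : M.rank = Fintype.card ι :=
  (linearIndependent_of_keyTriangular M c key hkey h0 h1).rank_matrix

/-- **The certificate principle**: if some row combinations `P * A` of `A` form a key-triangular
matrix with `|ι|` rows, then `|ι| ≤ rank A`. [folklore] -/
theorem card_le_rank_of_keyTriangular_mul {m : Type*} [Fintype m] (A : Matrix m κ F)
    (P : Matrix ι m F) (c : ι → κ) (key : ι → α) (hkey : Function.Injective key)
    (h0 : ∀ i, (P * A) i (c i) ≠ 0) (h1 : ∀ i j, key j < key i → (P * A) i (c j) = 0) :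
    Fintype.card ι ≤ A.rank := by
  rw [← rank_eq_card_of_keyTriangular (P * A) c key hkey h0 h1]
  exact Matrix.rank_mul_le_right P A

end Literature.LinearAlgebra.Matrix
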